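import Literature.Probability.LatticeModels.DomainDiscretisation
import Mathlib.Combinatorics.SimpleGraph.Walk.Operations
import HarnessLib

/-!
# Screening recursion for `SAWCircleScreening`, part XI: combinatorics of circle screens

Route `SAWCircleScreening` of `CriticalPhenomena/SAWScalingLimit`, support item
`ScreeningRecursion` (stmt-CriticalPhenomena-5468). The route's cruxes `ScreenOverlap` (S2) and
`NoDeepReturn` (S3) speak about a walk `γ` through `γ.walk.getVert i`, `i ≤ γ.walk.length`:
"the circle `C(c, r)` is crossed exactly once" is `∃ k, ∀ i ≤ |γ|, (dist(γᵢ, c) < r ↔ i ≤ k)`,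
the *canonical screen* is the smallest grid radius `rⱼ = 2ρ + jδ ≤ 3ρ` crossed exactly once
together with its exit edge `(γ_k, γ_{k+1})`, and a *deep return* is `Mρ ≤ dist(γᵢ, c)`,
`dist(γ_{i'}, c) < 3ρ` for some `i < i'`. This file is the list-level bookkeeping (on the
support `l = γ.support`, `γᵢ = l[i]`) used by the one-scale coupling step:

* `sc_iff_forall_of_decomp` — for `l = ins ++ out` with `ins ≠ []` inside `B(c, r)` and the
  head of `out` outside, "crossed exactly once" means "all of `out` is outside";
* `sc_iff_scIns_of_decomp` — for smaller radii `r' ≤ r` it is a condition on `ins` alone; hence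
  (`screen_iff_of_decomp`) the canonical screen is a function of `(ins, out.head)` only — the
  **transfer lemma** behind the exact screen;
* `sc_take_iff`, `screen_take_iff` — **proxy = true screen off deep returns**: the screen read on
  the prefix up to the first exit of `B(c, Mρ)` is the screen of the whole walk;
* `screen_unique` — at most one canonical screen datum per walk.

(The translation from the route's `getVert` phrasing is part XIb, `…ScreensWalk`.)

All folklore; no measures here. Mathlib anchors: `List.take`, `List.getElem_append`,
`SimpleGraph.Walk.getVert_eq_support_getElem`.
-/

open Set Metric
open Literature.Probability.LatticeModels

namespace Summit.CriticalPhenomena.SAWScalingLimit.Theorems.ScreeningRecursion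

variable {δ : ℝ} {c : ℂ}

/-! ## "Crossed exactly once" for a decomposed list -/

/-- **Crossed exactly once, decomposed form.** If `l = ins ++ out` with `ins ≠ []`, all points
of `ins` inside `B(c, r)`, `out ≠ []` and the first point of `out` outside, then
`∃ k, ∀ i < |l|, (dist(l[i], c) < r ↔ i ≤ k)` holds iff ALL points of `out` are outside.
[folklore] -/
theorem sc_iff_forall_of_decomp {r : ℝ} (ins out : List (Site 2)) (hins : ins ≠ [])
    (hin : ∀ w ∈ ins, dist (meshPoint δ w) c < r) (hout : out ≠ [])
    (hhead : r ≤ dist (meshPoint δ (out.head hout)) c) :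
    (∃ k : ℕ, ∀ i : ℕ, (hi : i < (ins ++ out).length) →
        (dist (meshPoint δ ((ins ++ out)[i])) c < r ↔ i ≤ k)) ↔
      ∀ w ∈ out, r ≤ dist (meshPoint δ w) c := by
  have hlen : (ins ++ out).length = ins.length + out.length := List.length_append
  have hinspos : 0 < ins.length := List.length_pos_iff.2 hins
  have houtpos : 0 < out.length := List.length_pos_iff.2 hout
  constructor
  · rintro ⟨k, hk⟩ w hw
    obtain ⟨m, hm, rfl⟩ := List.getElem_of_mem hw
    -- `k = ins.length - 1`: the head of `out` (index `ins.length`) is outside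
    have hk1 : ¬ ins.length ≤ k := by
      intro hle
      have h := (hk ins.length (by rw [hlen]; omega)).2 hle
      rw [List.getElem_append_right (le_refl _)] at h
      simp only [Nat.sub_self] at h
      rw [← List.head_eq_getElem_zero hout] at h
      linarith
    have h := hk (ins.length + m) (by rw [hlen]; omega)
    rw [List.getElem_append_right (by omega)] at h
    simp only [Nat.add_sub_cancel_left] at h
    by_contra hlt
    push Not at hlt
    have := h.1 hlt
    omega
  · intro hall
    refine ⟨ins.length - 1, fun i hi => ?_⟩
    by_cases hi' : i < ins.length
    · rw [List.getElem_append_left hi']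
      exact ⟨fun _ => by omega, fun _ => hin _ (List.getElem_mem _)⟩
    · push Not at hi'
      rw [List.getElem_append_right hi']
      constructor
      · intro h
        have := hall _ (List.getElem_mem (l := out) (n := i - ins.length) (by omega))
        linarith
      · intro h; omega

/-- **Smaller radii see only the inside part.** For `l = ins ++ out` with all of `out` outside
`B(c, r')`, "crossed exactly once at radius `r'`" is the condition
`∃ k < |ins|, ∀ i < |ins|, (dist(ins[i], c) < r' ↔ i ≤ k)` on `ins` alone. [folklore] -/
theorem sc_iff_scIns_of_decomp {r' : ℝ} (ins out : List (Site 2)) (hins : ins ≠ [])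
    (hout : ∀ w ∈ out, r' ≤ dist (meshPoint δ w) c) :
    (∃ k : ℕ, ∀ i : ℕ, (hi : i < (ins ++ out).length) →
        (dist (meshPoint δ ((ins ++ out)[i])) c < r' ↔ i ≤ k)) ↔
      ∃ k : ℕ, k < ins.length ∧ ∀ i : ℕ, (hi : i < ins.length) →
        (dist (meshPoint δ (ins[i])) c < r' ↔ i ≤ k) := by
  have hlen : (ins ++ out).length = ins.length + out.length := List.length_append
  have hinspos : 0 < ins.length := List.length_pos_iff.2 hins
  constructor
  · rintro ⟨k, hk⟩
    refine ⟨min k (ins.length - 1), by omega, fun i hi => ?_⟩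
    have h := hk i (by rw [hlen]; omega)
    rw [List.getElem_append_left hi] at h
    rw [h]
    omega
  · rintro ⟨k, hk, hk'⟩
    refine ⟨k, fun i hi => ?_⟩
    by_cases hi' : i < ins.length
    · rw [List.getElem_append_left hi']
      exact hk' i hi'
    · push Not at hi'
      rw [List.getElem_append_right hi']
      constructor
      · intro h
        have := hout _ (List.getElem_mem (l := out) (n := i - ins.length) (by omega))
        linarith
      · intro h; omega

/-- **The canonical screen is a function of `(ins, out.head)`** (transfer lemma). For
`l = ins ++ out` decomposed at radius `r = 2ρ + jδ` (`ins ≠ []` inside, `out ≠ []`, all of `out`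
outside), the canonical-screen event "`2ρ + jδ ≤ 3ρ`, radius `r` crossed exactly once with exit
edge `(x, y)` at positions `k, k+1`, and no smaller grid radius crossed exactly once" holds iff
`2ρ + jδ ≤ 3ρ`, `x = ins.getLast`, `y = out.head`, and for every `j' < j` the inside condition
of `sc_iff_scIns_of_decomp` fails — a statement not involving `out` beyond its head.
[folklore] -/
theorem screen_iff_of_decomp {ρ : ℝ} (hδ : 0 ≤ δ) {j : ℕ} {x y : Site 2} (ins out : List (Site 2))
    (hins : ins ≠ []) (hin : ∀ w ∈ ins, dist (meshPoint δ w) c < 2 * ρ + j * δ) (hout : out ≠ [])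
    (hall : ∀ w ∈ out, 2 * ρ + j * δ ≤ dist (meshPoint δ w) c) :
    (2 * ρ + j * δ ≤ 3 * ρ ∧
      (∃ k : ℕ, (∀ i : ℕ, (hi : i < (ins ++ out).length) →
          (dist (meshPoint δ ((ins ++ out)[i])) c < 2 * ρ + j * δ ↔ i ≤ k)) ∧
        (ins ++ out)[k]? = some x ∧ (ins ++ out)[k + 1]? = some y) ∧
      ∀ j' < j, ¬ ∃ k : ℕ, ∀ i : ℕ, (hi : i < (ins ++ out).length) →
          (dist (meshPoint δ ((ins ++ out)[i])) c < 2 * ρ + j' * δ ↔ i ≤ k)) ↔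
    (2 * ρ + j * δ ≤ 3 * ρ ∧ ins.getLast hins = x ∧ out.head hout = y ∧
      ∀ j' < j, ¬ ∃ k : ℕ, k < ins.length ∧ ∀ i : ℕ, (hi : i < ins.length) →
          (dist (meshPoint δ (ins[i])) c < 2 * ρ + j' * δ ↔ i ≤ k)) := by
  have hlen : (ins ++ out).length = ins.length + out.length := List.length_append
  have hinspos : 0 < ins.length := List.length_pos_iff.2 hins
  have houtpos : 0 < out.length := List.length_pos_iff.2 hout
  -- the minimality clauses agree (`out` is outside every smaller radius too)
  have hmin : ∀ j' < j, ((∃ k : ℕ, ∀ i : ℕ, (hi : i < (ins ++ out).length) →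
      (dist (meshPoint δ ((ins ++ out)[i])) c < 2 * ρ + j' * δ ↔ i ≤ k)) ↔
      ∃ k : ℕ, k < ins.length ∧ ∀ i : ℕ, (hi : i < ins.length) →
        (dist (meshPoint δ (ins[i])) c < 2 * ρ + j' * δ ↔ i ≤ k)) := by
    intro j' hj'
    refine sc_iff_scIns_of_decomp ins out hins fun w hw => ?_
    have h1 := hall w hw
    have h2 : (j' : ℝ) * δ ≤ j * δ := mul_le_mul_of_nonneg_right (by exact_mod_cast hj'.le) hδ
    linarith
  -- the main clause: `k` is forced to be `ins.length - 1`
  have hsc : ∀ k : ℕ, (∀ i : ℕ, (hi : i < (ins ++ out).length) →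
      (dist (meshPoint δ ((ins ++ out)[i])) c < 2 * ρ + j * δ ↔ i ≤ k)) → k = ins.length - 1 := by
    intro k hk
    have h1 := hk (ins.length - 1) (by rw [hlen]; omega)
    rw [List.getElem_append_left (by omega)] at h1
    have h2 := h1.1 (hin _ (List.getElem_mem _))
    have h3 := hk ins.length (by rw [hlen]; omega)
    rw [List.getElem_append_right (le_refl _)] at h3
    simp only [Nat.sub_self] at h3
    rw [← List.head_eq_getElem_zero hout] at h3
    have h4 : ¬ ins.length ≤ k := fun hle => by
      have := h3.2 hle; linarith [hall _ (List.head_mem hout)]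
    omega
  have hexists : ∃ k : ℕ, ∀ i : ℕ, (hi : i < (ins ++ out).length) →
      (dist (meshPoint δ ((ins ++ out)[i])) c < 2 * ρ + j * δ ↔ i ≤ k) :=
    (sc_iff_forall_of_decomp ins out hins hin hout (hall _ (List.head_mem hout))).2 hall
  have hx : (ins ++ out)[ins.length - 1]? = some (ins.getLast hins) := by
    rw [List.getElem?_append_left (by omega), List.getLast_eq_getElem]
    simp
  have hy : (ins ++ out)[ins.length - 1 + 1]? = some (out.head hout) := by
    rw [show ins.length - 1 + 1 = ins.length by omega, List.getElem?_append_right (le_refl _),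
      Nat.sub_self, List.head_eq_getElem_zero hout]
    simp [houtpos]
  constructor
  · rintro ⟨h3ρ, ⟨k, hk, hkx, hky⟩, hminl⟩
    have hk' := hsc k hk
    subst hk'
    rw [hx] at hkx; rw [hy] at hky
    refine ⟨h3ρ, Option.some.inj hkx, Option.some.inj hky, fun j' hj' h => ?_⟩
    exact hminl j' hj' ((hmin j' hj').2 h)
  · rintro ⟨h3ρ, rfl, rfl, hminl⟩
    refine ⟨h3ρ, ⟨ins.length - 1, hexists.choose_spec |> fun h => ?_, hx, hy⟩, fun j' hj' h =>
      hminl j' hj' ((hmin j' hj').1 h)⟩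
    have := hsc _ hexists.choose_spec
    rw [← this]
    exact h

/-! ## The proxy screen: reading the screen on the prefix up to the first exit of `B(c, Mρ)` -/

/-- **Off deep returns, truncation at the first exit of `B(c, Mρ)` does not change "crossed
exactly once"** (radii `r ≤ 3ρ`): if `l[τ]` is the first point at distance `≥ Mρ` and no later
point comes back within `3ρ`, then radius `r` is crossed exactly once by `l` iff by
`l.take (τ + 1)`, and in that case the crossing index is `< τ`. [folklore] -/
theorem sc_take_iff {ρ M r : ℝ} (hr : r ≤ 3 * ρ) (h3M : 3 * ρ < M * ρ) (l : List (Site 2)) {τ : ℕ}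
    (hτ : τ < l.length) (hτout : M * ρ ≤ dist (meshPoint δ (l[τ])) c)
    (hndr : ∀ i' : ℕ, (hi' : i' < l.length) → τ < i' → 3 * ρ ≤ dist (meshPoint δ (l[i'])) c) :
    (∃ k : ℕ, ∀ i : ℕ, (hi : i < l.length) → (dist (meshPoint δ (l[i])) c < r ↔ i ≤ k)) ↔
      ∃ k : ℕ, k < τ ∧ ∀ i : ℕ, (hi : i < (l.take (τ + 1)).length) →
        (dist (meshPoint δ ((l.take (τ + 1))[i])) c < r ↔ i ≤ k) := by
  have hlt : (l.take (τ + 1)).length = τ + 1 := by rw [List.length_take]; omega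
  constructor
  · rintro ⟨k, hk⟩
    have hkτ : k < τ := by
      by_contra hle
      push Not at hle
      have := (hk τ hτ).2 hle
      linarith
    refine ⟨k, hkτ, fun i hi => ?_⟩
    rw [List.getElem_take]
    exact hk i (by rw [hlt] at hi; omega)
  · rintro ⟨k, hkτ, hk⟩
    refine ⟨k, fun i hi => ?_⟩
    by_cases hiτ : i ≤ τ
    · have h := hk i (by rw [hlt]; omega)
      rw [List.getElem_take] at h
      exact h
    · push Not at hiτ
      constructor
      · intro h
        have := hndr i hi hiτ
        linarith
      · intro h; omega

/-- **Proxy screen = true screen off deep returns.** Under the hypotheses of `sc_take_iff`,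
the canonical-screen event (grid radii `2ρ + jδ ≤ 3ρ`, exit edge read at the crossing index)
holds for `l` iff it holds for the truncation `l.take (τ + 1)`. [folklore] -/
theorem screen_take_iff {ρ M : ℝ} (hδ : 0 ≤ δ) (h3M : 3 * ρ < M * ρ) (l : List (Site 2)) {τ : ℕ}
    (hτ : τ < l.length) (hτout : M * ρ ≤ dist (meshPoint δ (l[τ])) c)
    (hndr : ∀ i' : ℕ, (hi' : i' < l.length) → τ < i' → 3 * ρ ≤ dist (meshPoint δ (l[i'])) c)
    (j : ℕ) (x y : Site 2) :
    (2 * ρ + j * δ ≤ 3 * ρ ∧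
      (∃ k : ℕ, (∀ i : ℕ, (hi : i < l.length) →
          (dist (meshPoint δ (l[i])) c < 2 * ρ + j * δ ↔ i ≤ k)) ∧
        l[k]? = some x ∧ l[k + 1]? = some y) ∧
      ∀ j' < j, ¬ ∃ k : ℕ, ∀ i : ℕ, (hi : i < l.length) →
          (dist (meshPoint δ (l[i])) c < 2 * ρ + j' * δ ↔ i ≤ k)) ↔
    (2 * ρ + j * δ ≤ 3 * ρ ∧
      (∃ k : ℕ, (∀ i : ℕ, (hi : i < (l.take (τ + 1)).length) →
          (dist (meshPoint δ ((l.take (τ + 1))[i])) c < 2 * ρ + j * δ ↔ i ≤ k)) ∧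
        (l.take (τ + 1))[k]? = some x ∧ (l.take (τ + 1))[k + 1]? = some y) ∧
      ∀ j' < j, ¬ ∃ k : ℕ, ∀ i : ℕ, (hi : i < (l.take (τ + 1)).length) →
          (dist (meshPoint δ ((l.take (τ + 1))[i])) c < 2 * ρ + j' * δ ↔ i ≤ k)) := by
  have hlt : (l.take (τ + 1)).length = τ + 1 := by rw [List.length_take]; omega
  -- for any radius `≤ 3ρ`: the iff with the crossing index `< τ`
  have key : ∀ r : ℝ, r ≤ 3 * ρ →
      ((∃ k : ℕ, ∀ i : ℕ, (hi : i < l.length) → (dist (meshPoint δ (l[i])) c < r ↔ i ≤ k)) ↔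
        ∃ k : ℕ, ∀ i : ℕ, (hi : i < (l.take (τ + 1)).length) →
          (dist (meshPoint δ ((l.take (τ + 1))[i])) c < r ↔ i ≤ k)) := by
    intro r hr
    rw [sc_take_iff hr h3M l hτ hτout hndr]
    constructor
    · rintro ⟨k, -, hk⟩; exact ⟨k, hk⟩
    · rintro ⟨k, hk⟩
      refine ⟨k, ?_, hk⟩
      by_contra hle
      push Not at hle
      have h := (hk τ (by rw [hlt]; omega)).2 hle
      rw [List.getElem_take] at h
      linarith
  -- the crossing index is `< τ`, so the exit edge is read inside the truncation
  have hkτ : ∀ r : ℝ, r ≤ 3 * ρ → ∀ k : ℕ,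
      (∀ i : ℕ, (hi : i < l.length) → (dist (meshPoint δ (l[i])) c < r ↔ i ≤ k)) → k < τ := by
    intro r hr k hk
    by_contra hle
    push Not at hle
    have := (hk τ hτ).2 hle
    linarith
  have hkτ' : ∀ r : ℝ, r ≤ 3 * ρ → ∀ k : ℕ,
      (∀ i : ℕ, (hi : i < (l.take (τ + 1)).length) →
        (dist (meshPoint δ ((l.take (τ + 1))[i])) c < r ↔ i ≤ k)) → k < τ := by
    intro r hr k hk
    by_contra hle
    push Not at hle
    have h := (hk τ (by rw [hlt]; omega)).2 hle
    rw [List.getElem_take] at h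
    linarith
  have hget : ∀ k : ℕ, k < τ → (l.take (τ + 1))[k]? = l[k]? ∧ (l.take (τ + 1))[k + 1]? = l[k + 1]? := by
    intro k hk
    rw [List.getElem?_take, List.getElem?_take, if_pos (by omega), if_pos (by omega)]
    exact ⟨rfl, rfl⟩
  constructor
  · rintro ⟨h3ρ, ⟨k, hk, hkx, hky⟩, hmin⟩
    have hk' := hkτ _ h3ρ k hk
    refine ⟨h3ρ, ⟨k, ?_, ?_, ?_⟩, fun j' hj' h => hmin j' hj' ((key _ ?_).2 h)⟩
    · intro i hi
      rw [List.getElem_take]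
      exact hk i (by rw [hlt] at hi; omega)
    · rw [(hget k hk').1]; exact hkx
    · rw [(hget k hk').2]; exact hky
    · have : (j' : ℝ) * δ ≤ j * δ := mul_le_mul_of_nonneg_right (by exact_mod_cast hj'.le) hδ
      linarith
  · rintro ⟨h3ρ, ⟨k, hk, hkx, hky⟩, hmin⟩
    have hk' := hkτ' _ h3ρ k hk
    refine ⟨h3ρ, ⟨k, ?_, ?_, ?_⟩, fun j' hj' h => hmin j' hj' ((key _ ?_).1 h)⟩
    · obtain ⟨k₂, hk₂⟩ := (key _ h3ρ).2 ⟨k, hk⟩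
      -- `k₂ = k`: compare at index `k` and `k₂` inside the truncation
      have hk₂τ := hkτ _ h3ρ k₂ hk₂
      have e1 := hk k (by rw [hlt]; omega)
      have e2 := hk₂ k (by omega)
      have e3 := hk k₂ (by rw [hlt]; omega)
      have e4 := hk₂ k₂ (by omega)
      rw [List.getElem_take] at e1 e3
      have hkk : k = k₂ := by
        have a1 : k ≤ k₂ := (e2.1 (e1.2 le_rfl))
        have a2 : k₂ ≤ k := (e3.1 (e4.2 le_rfl))
        omega
      subst hkk
      exact hk₂
    · rw [← (hget k hk').1]; exact hkx
    · rw [← (hget k hk').2]; exact hky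
    · have : (j' : ℝ) * δ ≤ j * δ := mul_le_mul_of_nonneg_right (by exact_mod_cast hj'.le) hδ
      linarith

/-! ## Uniqueness of the canonical screen datum -/

/-- **At most one canonical screen datum per walk**: the grid index `j` is the least one whose
circle is crossed exactly once, the crossing index `k` is determined by the crossing condition,
and the exit edge is read at `k, k+1`. [folklore] -/
theorem screen_unique {ρ : ℝ} (l : List (Site 2)) {j j' : ℕ} {x y x' y' : Site 2}
    (h : 2 * ρ + j * δ ≤ 3 * ρ ∧
      (∃ k : ℕ, (∀ i : ℕ, (hi : i < l.length) →
          (dist (meshPoint δ (l[i])) c < 2 * ρ + j * δ ↔ i ≤ k)) ∧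
        l[k]? = some x ∧ l[k + 1]? = some y) ∧
      ∀ j'' < j, ¬ ∃ k : ℕ, ∀ i : ℕ, (hi : i < l.length) →
          (dist (meshPoint δ (l[i])) c < 2 * ρ + j'' * δ ↔ i ≤ k))
    (h' : 2 * ρ + j' * δ ≤ 3 * ρ ∧
      (∃ k : ℕ, (∀ i : ℕ, (hi : i < l.length) →
          (dist (meshPoint δ (l[i])) c < 2 * ρ + j' * δ ↔ i ≤ k)) ∧
        l[k]? = some x' ∧ l[k + 1]? = some y') ∧
      ∀ j'' < j', ¬ ∃ k : ℕ, ∀ i : ℕ, (hi : i < l.length) →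
          (dist (meshPoint δ (l[i])) c < 2 * ρ + j'' * δ ↔ i ≤ k)) :
    (j, x, y) = (j', x', y') := by
  obtain ⟨-, ⟨k, hk, hkx, hky⟩, hmin⟩ := h
  obtain ⟨-, ⟨k', hk', hkx', hky'⟩, hmin'⟩ := h'
  have hjj : j = j' := by
    rcases lt_trichotomy j j' with hlt | heq | hgt
    · exact absurd ⟨k, hk⟩ (hmin' j hlt)
    · exact heq
    · exact absurd ⟨k', hk'⟩ (hmin j' hgt)
  subst hjj
  have hklen : k < l.length := by
    rcases Nat.lt_or_ge k l.length with h | h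
    · exact h
    · rw [List.getElem?_eq_none (by omega)] at hkx; exact absurd hkx (by simp)
  have hklen' : k' < l.length := by
    rcases Nat.lt_or_ge k' l.length with h | h
    · exact h
    · rw [List.getElem?_eq_none (by omega)] at hkx'; exact absurd hkx' (by simp)
  have hkk : k = k' := by
    have a1 : k ≤ k' := (hk' k hklen).1 ((hk k hklen).2 le_rfl)
    have a2 : k' ≤ k := (hk k' hklen').1 ((hk' k' hklen').2 le_rfl)
    omega
  subst hkk
  rw [hkx] at hkx'; rw [hky] at hky'
  cases hkx'; cases hky'
  rfl

end Summit.CriticalPhenomena.SAWScalingLimit.Theorems.ScreeningRecursion
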